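import Summits.NavierStokesRegularity.FunctionalMining.TopEigDensityLocalIdentity
import Summits.NavierStokesRegularity.FunctionalMining.TopEigDensityIntegral
import HarnessLib

/-!
# FunctionalMining — COROLLARY 3′ (a) of F1 PART I with the hypothesis AS PRINTED: if `λ₁(S(v))` is
# simple at every point of `T³`, the heat dissipation of `∫ λ₁^q` is the integral of a non-negative
# density (grad-λ + rotation/tilt channels), with no eigenpair input

Search for candidate a priori estimates; no regularity claim. Cell `pub-nsfunc`, prove seat
(gen 23). `TopEigDensityIntegral.lean` (gen 22) proved Cor. 3′ (a) along a GIVEN smooth global top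
eigenpair. With the joint smoothness of `λ₁` at simple points (`TopEigDensityLocal.lean`) the
hypothesis becomes the one of the pen statement — `λ₁∘S` simple on all of `T³` (in gap form at every
point) —, and no global eigenvector field is needed (none need exist as a VECTOR field; the density is
sign-free):

* `TopEig.isSmooth_torusStrainTopEig_of_simple` — then `λ₁ = torusStrainTopEig v` is `C^∞` on `T³`;
* `TopEig.dirTopEig_strainFlat_eq_of_gapForm` — `μ(S(x); ΔS(x)) = eᵀS(Δv)(x)e` at a simple point;
* **`TopEig.heatDissipation_topEigMoment_eq_integral_of_simple`** — for `v` smooth and divergence free,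
  `q ≥ 1`:  `T(v) = ∫ [q(q−1)λ₁^{q−2}∑ₖ(∂ₖλ₁)² + qλ₁^{q−1}(Δλ₁ − μ(S;ΔS))] dx`
  (Danskin `T = −∫qλ₁^{q−1}μ`, the density identity, and `∫Δ(λ₁^q) = 0`);
* `TopEig.channelIntegrand_nonneg_of_simple` — the integrand is `≥ 0` pointwise, its second bracket
  being `Δλ₁(x) − μ(S;ΔS)(x) = 2∑ₖN′ₖᵀS(∂ₖv)(x)e ≥ 0` (`TopEig.laplacian_sub_dirTopEig_eq_of_gapForm`):
  SIEVELD's density (1) is exact, channel by channel, and `T(v) ≥ 0` termwise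
  (`TopEig.heatDissipation_topEigMoment_nonneg_of_simple`).

[ours; F1 PART I Cor. 3′ (a)]
-/

noncomputable section

open MeasureTheory Set Filter Topology Matrix
open scoped ContDiff

namespace Summit.NavierStokesRegularity.FunctionalMining

open Literature.Analysis Literature.Analysis.FunctionSpaces Literature.Analysis.FunctionSpaces.Torus
  Literature.Analysis.FluidPDE SharpClass.DirectorForm

namespace TopEig

variable {v : UnitAddTorus (Fin 3) → EuclideanSpace ℝ (Fin 3)}

/-! ## 1. Simple everywhere ⇒ `λ₁` is smooth on the torus -/

/-- **If `λ₁(S(v))` is simple (gap form) at every point, `λ₁` is `C^∞` on `T³`.** [ours; folklore —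
Kato II-§5] -/
theorem isSmooth_torusStrainTopEig_of_simple (hv : Torus.IsSmooth v)
    (hsimple : ∀ x : UnitAddTorus (Fin 3), ∃ (e : Fin 3 → ℝ) (lam g : ℝ), e ⬝ᵥ e = 1 ∧
      torusStrainMatrix v x *ᵥ e = lam • e ∧ 0 < g ∧
      ∀ w, w ⬝ᵥ e = 0 → w ⬝ᵥ torusStrainMatrix v x *ᵥ w ≤ (lam - g) * (w ⬝ᵥ w)) :
    Torus.IsSmooth (torusStrainTopEig v) := by
  unfold Torus.IsSmooth
  rw [← liftAt_zero_left]
  refine contDiff_iff_contDiffAt.2 fun w => ?_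
  obtain ⟨e, lam, g, he1, hSe, hg, hgap⟩ := hsimple ((0 : UnitAddTorus (Fin 3)) + proj w)
  obtain ⟨-, -, -, -, hcd⟩ := exists_smooth_topEigenvector_chart_of_gapForm hv he1 hSe hg hgap
  exact contDiffAt_liftAt_of_shift hcd

/-- At a simple point, **`μ(S(x); ΔS(x)) = eᵀS(Δv)(x)e`** (the top eigen-set is `{±e}`). [ours] -/
theorem dirTopEig_strainFlat_eq_of_gapForm {x : UnitAddTorus (Fin 3)} {e : Fin 3 → ℝ} {lam g : ℝ}
    (he1 : e ⬝ᵥ e = 1) (hSe : torusStrainMatrix v x *ᵥ e = lam • e) (hg : 0 < g)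
    (hgap : ∀ w, w ⬝ᵥ e = 0 → w ⬝ᵥ torusStrainMatrix v x *ᵥ w ≤ (lam - g) * (w ⬝ᵥ w))
    (u : UnitAddTorus (Fin 3) → EuclideanSpace ℝ (Fin 3)) :
    dirTopEig (StrainL4.strainFlat v x) (StrainL4.strainFlat u x) =
      e ⬝ᵥ (torusStrainMatrix u x *ᵥ e) := by
  have he1' : e ∈ unitSphere (Fin 3) := he1
  rw [← flat_torusStrainMatrix, ← flat_torusStrainMatrix,
    dirTopEig_eq_quad_of_gapForm he1' hg
      (gapForm_of_eigenvector (torusStrainMatrix_isSymm v x) he1' hSe hgap)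
      (by rw [quad_flat, hSe, dotProduct_smul, he1, smul_eq_mul, mul_one]),
    quad_flat]

/-- At a simple point, **`Δλ₁(x) − μ(S(x); ΔS(x))` is twice the channel sum**: there are `N′ₖ` with
`Δλ₁(x) − μ(S;ΔS)(x) = 2∑ₖ N′ₖᵀS(∂ₖv)(x)e`, each `N′ₖᵀS(∂ₖv)(x)e = λ|N′ₖ|² − N′ₖᵀS(x)N′ₖ ≥ 0`; in
particular `μ(S;ΔS)(x) ≤ Δλ₁(x)`. [ours; F1 PART I Prop. 3 (2)] -/
theorem laplacian_sub_dirTopEig_eq_of_gapForm (hv : Torus.IsSmooth v)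
    {x : UnitAddTorus (Fin 3)} {e : Fin 3 → ℝ} {lam g : ℝ} (he1 : e ⬝ᵥ e = 1)
    (hSe : torusStrainMatrix v x *ᵥ e = lam • e) (hg : 0 < g)
    (hgap : ∀ w, w ⬝ᵥ e = 0 → w ⬝ᵥ torusStrainMatrix v x *ᵥ w ≤ (lam - g) * (w ⬝ᵥ w)) :
    ∃ N' : Fin 3 → Fin 3 → ℝ,
      Torus.laplacian (torusStrainTopEig v) x -
          dirTopEig (StrainL4.strainFlat v x) (StrainL4.strainFlat (Torus.laplacian v) x) =
        2 * ∑ k, N' k ⬝ᵥ (torusStrainMatrix (Torus.partialDeriv k v) x *ᵥ e) ∧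
      (∀ k, N' k ⬝ᵥ (torusStrainMatrix (Torus.partialDeriv k v) x *ᵥ e) =
          lam * (N' k ⬝ᵥ N' k) - N' k ⬝ᵥ (torusStrainMatrix v x *ᵥ N' k) ∧
        0 ≤ N' k ⬝ᵥ (torusStrainMatrix (Torus.partialDeriv k v) x *ᵥ e)) ∧
      dirTopEig (StrainL4.strainFlat v x) (StrainL4.strainFlat (Torus.laplacian v) x) ≤
        Torus.laplacian (torusStrainTopEig v) x := by
  obtain ⟨N', hlap, hk⟩ := laplacian_torusStrainTopEig_eq_of_gapForm hv he1 hSe hg hgap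
  refine ⟨N', ?_, fun k => ⟨(hk k).2.2.1, (hk k).2.2.2⟩, ?_⟩
  · rw [hlap, dirTopEig_strainFlat_eq_of_gapForm he1 hSe hg hgap]
    ring
  · rw [dirTopEig_strainFlat_eq_of_gapForm he1 hSe hg hgap]
    exact laplacian_torusStrainTopEig_ge_of_gapForm hv he1 hSe hg hgap

/-! ## 2. COROLLARY 3′ (a): the dissipation as the integral of the channel density -/

/-- **COROLLARY 3′ (a) OF F1 PART I, HYPOTHESIS AS PRINTED.** Let `v` be smooth and divergence free on
`T³`, `q ≥ 1`, and let `λ₁(S(v))` be simple at EVERY point (gap form). Then, with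
`λ₁ = torusStrainTopEig v` (now `C^∞` and `> 0` on `T³`) and `μ = μ(S;ΔS)` the Danskin density,
`heatDissipation (∫(λ₁⁺)^q) v = ∫ [q(q−1)λ₁^{q−2}∑ₖ(∂ₖλ₁)² + qλ₁^{q−1}(Δλ₁ − μ(S;ΔS))] dx`
— Danskin's `T = −∫qλ₁^{q−1}μ`, the pointwise identity `Δ(λ₁^q) = q(q−1)λ₁^{q−2}|∇λ₁|² + qλ₁^{q−1}Δλ₁`
and `∫_{T³}Δ(λ₁^q) = 0`. The integrand is `F_q` of SIEVELD's (1): `Δλ₁ − μ = 2∑ₖ(channels) ≥ 0`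
(`laplacian_sub_dirTopEig_eq_of_gapForm`). [ours; F1 PART I Cor. 3′ (a)] -/
theorem heatDissipation_topEigMoment_eq_integral_of_simple {q : ℝ} (hq : 1 ≤ q)
    (hv : Torus.IsSmooth v) (hdiv : Torus.IsDivFree v)
    (hsimple : ∀ x : UnitAddTorus (Fin 3), ∃ (e : Fin 3 → ℝ) (lam g : ℝ), e ⬝ᵥ e = 1 ∧
      torusStrainMatrix v x *ᵥ e = lam • e ∧ 0 < g ∧
      ∀ w, w ⬝ᵥ e = 0 → w ⬝ᵥ torusStrainMatrix v x *ᵥ w ≤ (lam - g) * (w ⬝ᵥ w)) :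
    heatDissipation (torusTopEigMoment q) v =
      ∫ x, (q * (q - 1) * torusStrainTopEig v x ^ (q - 2) *
            ∑ k, Torus.partialDeriv k (torusStrainTopEig v) x ^ 2 +
          q * torusStrainTopEig v x ^ (q - 1) * (Torus.laplacian (torusStrainTopEig v) x -
            dirTopEig (StrainL4.strainFlat v x) (StrainL4.strainFlat (Torus.laplacian v) x))) := by
  have hls : Torus.IsSmooth (torusStrainTopEig v) := isSmooth_torusStrainTopEig_of_simple hv hsimple
  have hpos : ∀ x, 0 < torusStrainTopEig v x := fun x => by
    obtain ⟨e, lam, g, he1, hSe, hg, hgap⟩ := hsimple x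
    rw [torusStrainTopEig_eq_of_gapForm he1 hSe hg hgap]
    exact (lam_pos_of_gapForm_of_isDivFree hv hdiv he1 hSe hg hgap).2
  have hlq : Torus.IsSmooth (fun y => torusStrainTopEig v y ^ q) := isSmooth_rpow_of_pos hls hpos q
  have hD := integrable_danskinDensity hq hv hv.laplacian hdiv
  have hL := hlq.laplacian.integrable
  -- pointwise: the integrand is `Δ(λ₁^q) − qλ₁^{q−1}μ`
  have hpt : ∀ x, q * (q - 1) * torusStrainTopEig v x ^ (q - 2) *
        ∑ k, Torus.partialDeriv k (torusStrainTopEig v) x ^ 2 +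
      q * torusStrainTopEig v x ^ (q - 1) * (Torus.laplacian (torusStrainTopEig v) x -
        dirTopEig (StrainL4.strainFlat v x) (StrainL4.strainFlat (Torus.laplacian v) x)) =
      Torus.laplacian (fun y => torusStrainTopEig v y ^ q) x -
        q * torusStrainTopEig v x ^ (q - 1) *
          dirTopEig (StrainL4.strainFlat v x) (StrainL4.strainFlat (Torus.laplacian v) x) := by
    intro x
    rw [laplacian_rpow_of_pos hls hpos q x]
    ring
  rw [heatDissipation_topEigMoment_eq_integral hq hv hdiv]
  simp_rw [hpt]
  rw [integral_sub hL hD, integral_laplacian_eq_zero_of_isSmooth hlq, zero_sub]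

/-- **The integrand of Cor. 3′ (a) is non-negative** at every simple point (`q ≥ 1`, `λ₁ > 0`):
`q(q−1)λ₁^{q−2}∑ₖ(∂ₖλ₁)² ≥ 0` and `qλ₁^{q−1}(Δλ₁ − μ) ≥ 0`. [ours; F1 PART I Cor. 3′ (a)] -/
theorem channelIntegrand_nonneg_of_simple {q : ℝ} (hq : 1 ≤ q) (hv : Torus.IsSmooth v)
    {x : UnitAddTorus (Fin 3)} {e : Fin 3 → ℝ} {lam g : ℝ} (he1 : e ⬝ᵥ e = 1)
    (hSe : torusStrainMatrix v x *ᵥ e = lam • e) (hg : 0 < g)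
    (hgap : ∀ w, w ⬝ᵥ e = 0 → w ⬝ᵥ torusStrainMatrix v x *ᵥ w ≤ (lam - g) * (w ⬝ᵥ w))
    (hpos : 0 < lam) :
    0 ≤ q * (q - 1) * torusStrainTopEig v x ^ (q - 2) *
          ∑ k, Torus.partialDeriv k (torusStrainTopEig v) x ^ 2 +
        q * torusStrainTopEig v x ^ (q - 1) * (Torus.laplacian (torusStrainTopEig v) x -
          dirTopEig (StrainL4.strainFlat v x) (StrainL4.strainFlat (Torus.laplacian v) x)) := by
  have hx : torusStrainTopEig v x = lam := torusStrainTopEig_eq_of_gapForm he1 hSe hg hgap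
  obtain ⟨-, -, -, hle⟩ := laplacian_sub_dirTopEig_eq_of_gapForm hv he1 hSe hg hgap
  rw [hx]
  have hq0 : 0 ≤ q := by linarith
  have hq1 : 0 ≤ q - 1 := by linarith
  have hp2 : 0 ≤ lam ^ (q - 2) := Real.rpow_nonneg hpos.le _
  have hp1 : 0 ≤ lam ^ (q - 1) := Real.rpow_nonneg hpos.le _
  have hs : 0 ≤ ∑ k, Torus.partialDeriv k (torusStrainTopEig v) x ^ 2 :=
    Finset.sum_nonneg fun k _ => sq_nonneg _
  have hd : 0 ≤ Torus.laplacian (torusStrainTopEig v) x -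
      dirTopEig (StrainL4.strainFlat v x) (StrainL4.strainFlat (Torus.laplacian v) x) := by
    linarith
  positivity

/-- **`T(v) ≥ 0`, termwise, when `λ₁` is simple everywhere** (the heat sieve in the exact form of
Cor. 3′ (a): the dissipation is the integral of a pointwise non-negative channel density). [ours] -/
theorem heatDissipation_topEigMoment_nonneg_of_simple {q : ℝ} (hq : 1 ≤ q)
    (hv : Torus.IsSmooth v) (hdiv : Torus.IsDivFree v)
    (hsimple : ∀ x : UnitAddTorus (Fin 3), ∃ (e : Fin 3 → ℝ) (lam g : ℝ), e ⬝ᵥ e = 1 ∧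
      torusStrainMatrix v x *ᵥ e = lam • e ∧ 0 < g ∧
      ∀ w, w ⬝ᵥ e = 0 → w ⬝ᵥ torusStrainMatrix v x *ᵥ w ≤ (lam - g) * (w ⬝ᵥ w)) :
    0 ≤ heatDissipation (torusTopEigMoment q) v := by
  rw [heatDissipation_topEigMoment_eq_integral_of_simple hq hv hdiv hsimple]
  refine integral_nonneg fun x => ?_
  obtain ⟨e, lam, g, he1, hSe, hg, hgap⟩ := hsimple x
  exact channelIntegrand_nonneg_of_simple hq hv he1 hSe hg hgap
    (lam_pos_of_gapForm_of_isDivFree hv hdiv he1 hSe hg hgap).2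

end TopEig

end Summit.NavierStokesRegularity.FunctionalMining

end
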